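import Mathlib.Algebra.Order.BigOperators.Group.Finset
import Mathlib.Combinatorics.Enumerative.DoubleCounting
import Mathlib.Data.Nat.Choose.Sum
import Mathlib.Tactic.LinearCombination
import Summits.CriticalPhenomena.PercolationContinuityZ3.Theorems.PercNearOneGluingNoHeavyLowerTailSahiCTCKleitmanDensityT
import HarnessLib

/-!
# `NoHeavyLowerTail` (crux stmt-CriticalPhenomena-4575), P3 lane: preparation for the PINNED `t`-density of the Kleitman surplus

Counting lemmas for a pinned vertex `d` of a sub-cube `(D, s)`: the pinned / unpinned handshakes of the common `(t+1)`-sets,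
their split under deleting a vertex `v` and their transport to the link at `v`, the split of the common trace at `d`, full local
LYM for the common trace at any number of points, `cH` at `2t` and `2t + 1` points, and the integer arithmetic of one peeling step
(`pinnedT_step_arith`).  Used by `pinnedT_le_kap`. [this work]
-/

namespace Summit.CriticalPhenomena.PercolationContinuityZ3.Theorems.SahiCTCForms

open Finset

variable {α : Type*} [DecidableEq α]

/-! ### Pinned counts: handshakes, deletion split, link transport, trace split -/

section PinnedCounts
variable {𝒳 𝒵 : Finset (Finset α)} {D s : Finset α} {t : ℕ} {d v : α}

/-- Double counting of incidences between points of `s'` and a set family. [folklore] -/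
theorem sum_card_filter_mem (s' : Finset α) (𝒲 : Finset (Finset α)) :
    ∑ u ∈ s', #(𝒲.filter fun w => u ∈ w) = ∑ w ∈ 𝒲, #(s'.filter fun u => u ∈ w) := by
  have h := sum_card_bipartiteAbove_eq_sum_card_bipartiteBelow (s := s') (t := 𝒲) (r := fun u w => u ∈ w)
  simpa only [bipartiteAbove, bipartiteBelow] using h

/-- Pinned handshake: the common `(t+1)`-sets through `d` have total degree `t · g` on `s ∖ d`. [this work] -/
theorem sum_pinned_degree_eq :
    ∑ u ∈ s.erase d, #(((csetsT 𝒳 𝒵 D s (t + 1)).filter fun w => d ∈ w).filter fun w => u ∈ w)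
      = t * #((csetsT 𝒳 𝒵 D s (t + 1)).filter fun w => d ∈ w) := by
  rw [sum_card_filter_mem]
  have h : ∀ w ∈ (csetsT 𝒳 𝒵 D s (t + 1)).filter (fun w => d ∈ w), #((s.erase d).filter fun u => u ∈ w) = t := by
    intro w hw
    obtain ⟨hwW, hdw⟩ := mem_filter.1 hw
    obtain ⟨hws, hwt, -, -⟩ := mem_csetsT.1 hwW
    have e : (s.erase d).filter (fun u => u ∈ w) = w.erase d := by
      ext u; simp only [mem_filter, mem_erase]
      constructor
      · rintro ⟨⟨hud, -⟩, huw⟩; exact ⟨hud, huw⟩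
      · rintro ⟨hud, huw⟩; exact ⟨⟨hud, hws huw⟩, huw⟩
    rw [e, card_erase_of_mem hdw, hwt, Nat.add_sub_cancel]
  rw [sum_congr rfl h, sum_const, smul_eq_mul, mul_comm]

/-- Unpinned handshake: the common `(t+1)`-sets avoiding `d` have total degree `(t+1) · ε` on `s ∖ d`. [this work] -/
theorem sum_unpinned_degree_eq :
    ∑ u ∈ s.erase d, #(((csetsT 𝒳 𝒵 D s (t + 1)).filter fun w => d ∉ w).filter fun w => u ∈ w)
      = (t + 1) * #((csetsT 𝒳 𝒵 D s (t + 1)).filter fun w => d ∉ w) := by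
  rw [sum_card_filter_mem]
  have h : ∀ w ∈ (csetsT 𝒳 𝒵 D s (t + 1)).filter (fun w => d ∉ w), #((s.erase d).filter fun u => u ∈ w) = t + 1 := by
    intro w hw
    obtain ⟨hwW, hdw⟩ := mem_filter.1 hw
    obtain ⟨hws, hwt, -, -⟩ := mem_csetsT.1 hwW
    have e : (s.erase d).filter (fun u => u ∈ w) = w := by
      ext u; simp only [mem_filter, mem_erase]
      constructor
      · rintro ⟨-, huw⟩; exact huw
      · intro huw; exact ⟨⟨fun h => hdw (h ▸ huw), hws huw⟩, huw⟩
    rw [e, hwt]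
  rw [sum_congr rfl h, sum_const, smul_eq_mul, mul_comm]

/-- A filtered count of common `t`-sets splits into those avoiding `v` (the deletion cube) and those through `v`. [this work] -/
theorem card_filter_csetsT_eq_erase_add (v : α) (p : Finset α → Prop) [DecidablePred p] :
    #((csetsT 𝒳 𝒵 D s t).filter p)
      = #((csetsT 𝒳 𝒵 D (s.erase v) t).filter p) + #(((csetsT 𝒳 𝒵 D s t).filter p).filter fun w => v ∈ w) := by
  have e1 : (csetsT 𝒳 𝒵 D (s.erase v) t).filter p = ((csetsT 𝒳 𝒵 D s t).filter p).filter fun w => v ∉ w := by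
    rw [csetsT_erase, filter_filter, filter_filter]
    exact filter_congr fun w _ => and_comm
  have e2 : (((csetsT 𝒳 𝒵 D s t).filter p).filter fun w => v ∈ w)
      = ((csetsT 𝒳 𝒵 D s t).filter p).filter fun w => ¬ (v ∉ w) := filter_congr fun w _ => by rw [not_not]
  rw [e1, e2]
  exact (card_filter_add_card_filter_not _).symm

/-- Link transport: the filtered common `(t+1)`-sets through `v`, with `v` erased, are filtered common `t`-sets of the link at `v`
(for a predicate stable under erasing `v`). [this work] -/
theorem card_filter_filter_mem_le_link (p : Finset α → Prop) [DecidablePred p] (hp : ∀ w : Finset α, p w → p (w.erase v)) :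
    #((((csetsT 𝒳 𝒵 D s (t + 1)).filter p)).filter fun w => v ∈ w)
      ≤ #((csetsT 𝒳 𝒵 (insert v D) (s.erase v) t).filter p) := by
  refine card_le_card_of_injOn (fun w => w.erase v) (fun w hw => ?_) (fun w hw w' hw' h => ?_)
  · have hw' := Finset.mem_coe.1 hw
    rw [mem_filter, mem_filter] at hw'
    obtain ⟨⟨hwW, hpw⟩, hvw⟩ := hw'
    obtain ⟨hws, hwt, hX, hZ⟩ := mem_csetsT.1 hwW
    have e : insert v D ∪ w.erase v = D ∪ w := by
      ext x; simp only [mem_union, mem_insert, mem_erase]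
      constructor
      · rintro ((rfl | hx) | ⟨_, hx⟩)
        · exact Or.inr hvw
        · exact Or.inl hx
        · exact Or.inr hx
      · rintro (hx | hx)
        · exact Or.inl (Or.inr hx)
        · by_cases hxv : x = v
          · exact Or.inl (Or.inl hxv)
          · exact Or.inr ⟨hxv, hx⟩
    refine Finset.mem_coe.2 (mem_filter.2 ⟨mem_csetsT.2 ⟨fun x hx => ?_, ?_, ?_, ?_⟩, hp w hpw⟩)
    · exact mem_erase.2 ⟨ne_of_mem_erase hx, hws (mem_of_mem_erase hx)⟩
    · rw [card_erase_of_mem hvw, hwt, Nat.add_sub_cancel]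
    · rw [e]; exact hX
    · rw [e]; exact hZ
  · have h1 : v ∈ w := (mem_filter.1 (Finset.mem_coe.1 hw)).2
    have h2 : v ∈ w' := (mem_filter.1 (Finset.mem_coe.1 hw')).2
    have h' : w.erase v = w'.erase v := h
    rw [← insert_erase h1, h', insert_erase h2]

/-- The members of the common trace avoiding `d` form the common trace of the cube with `d` erased. [this work] -/
theorem card_inter_filter_not_mem_eq (d : α) :
    #((tr 𝒳 D s ∩ tr 𝒵 D s).filter fun U => d ∉ U) = #(tr 𝒳 D (s.erase d) ∩ tr 𝒵 D (s.erase d)) := by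
  congr 1; ext U
  simp only [mem_filter, mem_inter, mem_tr_erase_iff]
  tauto

/-- The common trace of the link cube at `d` injects (by `insert d`) into the members of the common trace through `d`. [this work] -/
theorem card_link_inter_le_card_filter_mem (hd : d ∈ s) :
    #(tr 𝒳 (insert d D) (s.erase d) ∩ tr 𝒵 (insert d D) (s.erase d)) ≤ #((tr 𝒳 D s ∩ tr 𝒵 D s).filter fun U => d ∈ U) := by
  refine card_le_card_of_injOn (fun R => insert d R) (fun R hR => ?_) (fun R hR R' hR' h => ?_)
  · obtain ⟨hRX, hRZ⟩ := mem_inter.1 (Finset.mem_coe.1 hR)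
    obtain ⟨_, hX⟩ := (mem_tr_insert_iff hd).1 hRX
    obtain ⟨_, hZ⟩ := (mem_tr_insert_iff hd).1 hRZ
    exact Finset.mem_coe.2 (mem_filter.2 ⟨mem_inter.2 ⟨hX, hZ⟩, mem_insert_self d R⟩)
  · have h1 : d ∉ R := ((mem_tr_insert_iff hd).1 (mem_inter.1 (Finset.mem_coe.1 hR)).1).1
    have h2 : d ∉ R' := ((mem_tr_insert_iff hd).1 (mem_inter.1 (Finset.mem_coe.1 hR')).1).1
    have h' : insert d R = insert d R' := h
    rw [← erase_insert h1, h', erase_insert h2]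

/-- Full local LYM upwards for the common trace (all `#s`): `(Σ_{j ≤ #s − t} C(#s, j)) · #W_t ≤ C(#s, t) · #(common trace)`,
the layers `i = t..#s` counted by `choose_mul_card_csetsT_le_level`. [folklore] -/
theorem lym_mul_card_le_card_inter (h𝒳 : IsUpperSet (𝒳 : Set (Finset α))) (h𝒵 : IsUpperSet (𝒵 : Set (Finset α))) :
    (∑ j ∈ range (#s + 1 - t), (#s).choose j) * #(csetsT 𝒳 𝒵 D s t) ≤ (#s).choose t * #(tr 𝒳 D s ∩ tr 𝒵 D s) := by
  set n := #s with hn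
  rw [sum_mul]
  have hdisj : ∀ j ∈ range (n + 1 - t), ∀ j' ∈ range (n + 1 - t), j ≠ j' →
      Disjoint (clevel 𝒳 𝒵 D s (n - j)) (clevel 𝒳 𝒵 D s (n - j')) := fun j hj j' hj' hjj' => by
    refine disjoint_filter.2 fun U _ h1 h2 => hjj' ?_
    have hj1 := mem_range.1 hj; have hj2 := mem_range.1 hj'
    omega
  have hsub : (range (n + 1 - t)).biUnion (fun j => clevel 𝒳 𝒵 D s (n - j)) ⊆ tr 𝒳 D s ∩ tr 𝒵 D s :=
    biUnion_subset.2 fun j _ => filter_subset _ _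
  have hcard := card_le_card hsub
  rw [card_biUnion hdisj] at hcard
  calc ∑ j ∈ range (n + 1 - t), n.choose j * #(csetsT 𝒳 𝒵 D s t)
      ≤ ∑ j ∈ range (n + 1 - t), n.choose t * #(clevel 𝒳 𝒵 D s (n - j)) := by
        refine sum_le_sum fun j hj => ?_
        have hj' := mem_range.1 hj
        have e : n.choose j = n.choose (n - j) := (Nat.choose_symm (by omega)).symm
        rw [e]
        exact choose_mul_card_csetsT_le_level h𝒳 h𝒵 (n - j) (by omega) (by omega)
    _ = n.choose t * ∑ j ∈ range (n + 1 - t), #(clevel 𝒳 𝒵 D s (n - j)) := by rw [mul_sum]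
    _ ≤ n.choose t * #(tr 𝒳 D s ∩ tr 𝒵 D s) := Nat.mul_le_mul_left _ hcard

end PinnedCounts

/-! ### Arithmetic: `cH` at `2t` points, and the peeling step -/

section Arith

/-- `cH t (2t) = Σ_{j<t} C(2t, j)`. [this work] -/
theorem cH_two_mul (t : ℕ) : cH t (2 * t) = ∑ j ∈ range t, (2 * t).choose j := by
  unfold cH; rw [show min t (2 * t + 1 - t) = t from by omega]

/-- Pascal for `cH` at the edge of its range: `cH (t+1) (2t+1) = Σ_{j ≤ t} C(2t, j) + cH t (2t)`. [this work] -/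
theorem cH_succ_two_mul_succ (t : ℕ) :
    cH (t + 1) (2 * t + 1) = (∑ j ∈ range (t + 1), (2 * t).choose j) + cH t (2 * t) := by
  rw [cH_two_mul]
  unfold cH
  rw [show min (t + 1) (2 * t + 1 + 1 - (t + 1)) = t + 1 from by omega]
  rw [sum_range_succ' (fun j => (2 * t + 1).choose j), sum_range_succ' (fun j => (2 * t).choose j)]
  simp only [Nat.choose_zero_right, Nat.choose_succ_succ', sum_add_distrib]
  ring

/-- The arithmetic of the pinned peeling step (integer form).  Deletion bound `h0` (normalised rates `P0/c0`, `Q0/c0'`), link bound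
`h1` (rates `P1/c1`, `Q1/c0`), vertex recursion `hk`, the maximal-functional choice of the peeled vertex `hmax` (handshakes folded in),
and the four binomial identities `i1–i4` relating `c0 = C(m,t)`, `c1 = C(m,t−1)`, `c0' = C(m,t+1)` (`m = n − 1`) to `K = C(n,t)`,
`K' = C(n,t+1)`, give the bound at `n + 1` points with rates `(P0+P1)/K` and `(Q0+Q1)/K'`. [this work] -/
theorem pinnedT_step_arith (κ κ0 κ1 g e x y n t P0 Q0 P1 Q1 c0 c0' c1 K K' α β : ℤ)
    (hk : κ0 + κ1 ≤ κ) (h0 : P0 * c0' * (g - x) + Q0 * c0 * (e - y) ≤ c0 * c0' * κ0)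
    (h1 : P1 * c0 * x + Q1 * c1 * y ≤ c1 * c0 * κ1)
    (hα : α = P1 * c0 * c0' - P0 * c1 * c0') (hβ : β = Q1 * c1 * c0' - Q0 * c0 * c1)
    (hmax : t * α * g + (t + 1) * β * e ≤ n * (α * x + β * y))
    (i1 : (n - t) * K = (t + 1) * K') (i2 : n * c1 = t * K) (i3 : n * c0' = (n - t - 1) * K') (i4 : n * c0 = (t + 1) * K')
    (hc0' : 0 ≤ c0') (hc1 : 0 ≤ c1) (hcc : 0 ≤ c0 * c0' * c1) (hn : 0 ≤ n)
    (hD : 0 < t * (t + 1) * (n - t - 1) * K') :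
    (P0 + P1) * K' * g + (Q0 + Q1) * K * e ≤ K * K' * κ := by
  have A1 := mul_le_mul_of_nonneg_left h0 hc1
  have A2 := mul_le_mul_of_nonneg_left h1 hc0'
  have A3 : c0 * c0' * c1 * (κ0 + κ1) ≤ c0 * c0' * c1 * κ := mul_le_mul_of_nonneg_left hk hcc
  have S1 : P0 * c0' * c1 * g + Q0 * c0 * c1 * e + α * x + β * y ≤ c0 * c0' * c1 * κ := by
    have e1 : P0 * c0' * c1 * g + Q0 * c0 * c1 * e + α * x + β * y
        = c1 * (P0 * c0' * (g - x) + Q0 * c0 * (e - y)) + c0' * (P1 * c0 * x + Q1 * c1 * y) := by rw [hα, hβ]; ring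
    have e2 : c1 * (c0 * c0' * κ0) + c0' * (c1 * c0 * κ1) = c0 * c0' * c1 * (κ0 + κ1) := by ring
    rw [e1]; linarith
  have S2 : n * (P0 * c0' * c1 * g) + n * (Q0 * c0 * c1 * e) + t * α * g + (t + 1) * β * e ≤ n * (c0 * c0' * c1 * κ) := by
    have h := mul_le_mul_of_nonneg_left S1 hn
    have e1 : n * (P0 * c0' * c1 * g + Q0 * c0 * c1 * e + α * x + β * y)
        = n * (P0 * c0' * c1 * g) + n * (Q0 * c0 * c1 * e) + n * (α * x + β * y) := by ring
    linarith
  have S3 := mul_le_mul_of_nonneg_left S2 (mul_nonneg hn hn)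
  have eL : n * n * (n * (P0 * c0' * c1 * g) + n * (Q0 * c0 * c1 * e) + t * α * g + (t + 1) * β * e)
      = t * (t + 1) * (n - t - 1) * K' * ((P0 + P1) * K' * g + (Q0 + Q1) * K * e) := by
    rw [hα, hβ]
    linear_combination (n * P0 * g * (n * c1) + t * g * P1 * (t + 1) * K' - t * g * P0 * t * K + (t + 1) * e * Q1 * t * K) * i3
      + (n * P0 * g * (n - t - 1) * K' + n * Q0 * e * (t + 1) * K' - t * g * P0 * (n * c0') + (t + 1) * e * Q1 * (n * c0')
          - (t + 1) * e * Q0 * (t + 1) * K') * i2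
      + (n * Q0 * e * (n * c1) + t * g * P1 * (n * c0') - (t + 1) * e * Q0 * (n * c1)) * i4
      + (P0 * t * (n - t - 1) * K' * g) * i1
  have eR : n * n * (n * (c0 * c0' * c1 * κ)) = t * (t + 1) * (n - t - 1) * K' * (K * K' * κ) := by
    linear_combination (κ * (n * c0') * (n * c1)) * i4 + (κ * (t + 1) * K' * (n * c1)) * i3 + (κ * (t + 1) * K' * (n - t - 1) * K') * i2
  have S4 : t * (t + 1) * (n - t - 1) * K' * ((P0 + P1) * K' * g + (Q0 + Q1) * K * e)
      ≤ t * (t + 1) * (n - t - 1) * K' * (K * K' * κ) := by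
    rw [← eL, ← eR]; exact S3
  exact le_of_mul_le_mul_left S4 hD

end Arith

end Summit.CriticalPhenomena.PercolationContinuityZ3.Theorems.SahiCTCForms
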